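import Summits.Ventures.YMGap.RobustBall.LocalScreeningOnBall
import Summits.Ventures.YMGap.RobustBall.LoopSourceScreening
import Summits.Ventures.YMGap.RobustBall.LocalSourceScreeningS
import Summits.Ventures.YMGap.RobustBall.LoopSourceScreeningS
import Summits.Ventures.YMGap.RobustBall.ActionTruncationRate
import HarnessLib

/-!
# Venture statement — YMGap (cell `pub-ymgap`) — CONJUNCT BODIES T64 (V23, block 1 of 1)

STATUS: BOOKED by lead g9 (R311, bus 2026-08-24T04:13:31Z): «V23 = T64 — local-source screening (SU(2)/SU(N)/tier-2), action-truncation rate and loop-ball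
source screening on the strong-coupling ball (rb-p1; parents LocalScreeningOnBall / LoopSourceScreening / LocalSourceScreeningS / LoopSourceScreeningS /
ActionTruncationRate in the tree); finite-lattice strong-coupling statements, constants not sharp, nothing continuum.»  FILED by p3 g8 as the R299 fallback
filer (p2 has no live seat), `--kind definition`, review lane, one dry-run + one filing (R309/R310: not before 05:00Z 2026-08-24).  First (and only) V23 block file (the V22 block files were
`StatementConjunctsV22.lean (T55, T56, T57)`, `…V22B.lean (T58, T59, T46, T60)`, `…V22C.lean (T62, T63, T65)`, `…V22D.lean (T61)`, indexed by
`YMGapStatementV1_12`, `StatementIndex.lean` commit dcf266aae3d2).  This owner set turned GREEN on 2026-08-24 ≈ 04:10Z (its last parent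
`RobustBall/LoopSourceScreeningS.lean` is a tree file since 2026-08-23 18:26Z; its farm olean built during the night's backlog drain; by-import farm check of this
block rc 0 / 0 warnings / 0 sorry, `T64_SourceScreeningAndTruncation_holds` axioms {propext, Classical.choice, Quot.sound}).  Texts, VERBATIM from the owner file:
T64a–e (screening of local / loop sources and action truncation at the clustering rate, uniformly on the tier-1 and tier-2 balls, incl. the `SU(2)` Wilson point
with one loop of any strength; rb-p1 g5 `HOME/pub-ymgap-rb-p1/T-texts-rbp1g5.lean` bf6acb27640a3a1a).  Only decl names change (map of record
`HOME/lean/v23-prestage-p3/RENAMES-V23.txt`, numbers RESERVED by the lead: R294, V22 BOOKING 2026-08-23T23:50:48Z «V23 = T64a–e·T64 (rb-p1) …»); the consolidating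
conjunction `T64_SourceScreeningAndTruncation := T64a ∧ T64b ∧ T64c ∧ T64d ∧ T64e` is the pre-stage default (one per owner file); built mechanically by
`HOME/lean/v23-prestage-p3/mkmono23.py` (= p2's V22 `mkmono.py` with V23 section names); byte-compare `bytecmp.py --map` = verbatim-modulo-map.  The other V23-reserved numbers (T65c ds-4, T66a–e ds-3,
T67a–d + T68a rb-p2) are NOT in this file: their parent modules are not tree files yet (numbered-PENDING discipline of R294); they go to a later block.

HONEST FRAMING. WHAT THIS IS: bodies `Tk_… : Prop` + witnesses `Tk_…_holds`, kernel-checked with NO hypothesis, closing by TREE constants only. STRONG-COUPLING LATTICE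
statements about `SU(2)` / `SU(N)` lattice Yang–Mills with the Wilson action and the typed perturbation balls: for every member of the ball, a bounded local
modification of the action (any strength, any range) moves the expectation of a Lipschitz cylinder observable at distance `d` by at most `A · min(B,4) · e^{−m d} · #Λ · K_F`,
with `m` the one-sided Dobrushin-comparison rate (a comparison LOWER bound on the screening rate, not a computed correlation length); likewise for truncating the
action.  Every window, radius or rate is where a BOUND closes, not a transition.  WHAT THIS IS NOT: no sharp constants, nothing about the crossover, scaling, a
continuum limit, confinement in the continuum, or the Yang–Mills Millennium problem.
-/

noncomputable section

namespace Summit.Ventures.YMGap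

/-! ### OWNER FILE `pub-ymgap-rb-p1/T-texts-rbp1g5.lean` (sha16 bf6acb27640a3a1a) — section `V23_rbp1_Screening` -/
section V23_rbp1_Screening

/-!
# T-text CANDIDATES (rb-p1 g5 → p3): LOCAL SOURCES ARE SCREENED AT THE CLUSTERING RATE — numbering / naming is p3's;
# bodies tree-checked

HONEST FRAMING: strong-coupling LATTICE statements; «screening» = for every member of the tier-1 ball, every bounded
modification of the action supported (link-wise) in a finite link set `S` (ANY strength, ANY range) and EVERY DLR state of
the modified action, a Lipschitz cylinder observable (`Λ`, `K_F`) at `ℓ^∞`-distance `d(Λ,S)` from `S` has the same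
expectation as in the one state of the member up to `A · min(B,4) · e^{−m d(Λ,S)} · #Λ · K_F` (`B` = the source's one-link
oscillation load; `min(B,4)`: linear response capped by the Kantorovich–Rubinstein diameter); `m` is the one-sided
Dobrushin-comparison screening rate (= the clustering rate of the uniform rows); nothing continuum / Clay.
-/



open MeasureTheory ProbabilityTheory
open scoped NNReal
open Literature.Probability.LatticeModels
open Literature.MathematicalPhysics.QuantumLattice
open Literature.MathematicalPhysics.QuantumFieldTheory hiding ZdEdge Site
open Summit.Ventures.YMGap.RobustBall

/-- **T_H — track Y2, LOCAL SOURCES ARE SCREENED AT THE CLUSTERING RATE, UNIFORMLY ON THE TIER-1 BALL; `SU(2)`, `d = 4`,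
HYPOTHESIS-FREE** ('t Hooft `β_W/4`, bare `β_W/2`): (i) for every range `R` and radii `(ε₀, ε₁)` with
`6|β_W| e^{ε₀} + e^{ε₀/2} √(2/3) ε₁ ≤ ρ`, `1/2 ≤ ρ < 1`: `LocalScreeningOnBallZd 4 2 (β_W/4) ε₀ ε₁ R ((1−ρ)/max(1,R)) (√2/(1−ρ))` —
for EVERY member of `MemBallZd ε₀ ε₁ R`, EVERY bounded adapted source `V` loading only the links of a finite set `S` (loads
`≤ B`), every DLR state `μ` of the member and EVERY DLR state `ν` of the member with the source added, every Lipschitz cylinder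
`F` (`Λ`, `K_F`): `|∫F dμ − ∫F dν| ≤ √2/(1−ρ) · min(B,4) · e^{−((1−ρ)/max(1,R)) d(Λ,S)} · #Λ · K_F`
(`RobustBall.su2_localScreeningOnBallZd_dim4`, seat rb-p1); (ii) the cell of record `(β_W; ε₀, ε₁) = (1/8; 1/10, 1/20)`: rate
`(1/8)/max(1,R)`, constant `8√2` (`RobustBall.su2_localScreeningOnBallZd_1_8`); (iii) THE WILSON POINT, ONE LOOP OF ANY STRENGTH:
for `0 ≤ β_W ≤ 1/12`, every closed lattice walk `w` in `ℤ⁴` and EVERY real `t`: every DLR state `μ` of `SU(2)` Wilson on `ℤ⁴` (bare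
`β_W/2`) and EVERY DLR state `ν` of the action with the source `t · Re tr U_w/2` inserted satisfy, for every Lipschitz cylinder `F`
(`Λ`, `K_F`): `|∫F dμ − ∫F dν| ≤ 4√2 · 2^{−⌊d(Λ,w)⌋} · #Λ · K_F` — the constant does not see `t`
(`RobustBall.su2_wilson_singleLoop_upTo_oneTwelfth`; loop FAMILIES of any size and strength: `RobustBall.su2_wilson_loopSource_upTo_oneTwelfth'`). -/
def T64a_LocalSourceScreening : Prop :=
  (∀ (βW ε₀ ε₁ ρ R : ℝ), 6 * |βW| * Real.exp ε₀ + Real.exp (ε₀ / 2) * Real.sqrt (2 / 3) * ε₁ ≤ ρ → 1 / 2 ≤ ρ → ρ < 1 →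
      LocalScreeningOnBallZd 4 2 (βW / 4) ε₀ ε₁ R ((1 - ρ) / max 1 R) (Real.sqrt 2 / (1 - ρ))) ∧
    (∀ R : ℝ, LocalScreeningOnBallZd 4 2 ((1 / 8 : ℝ) / 4) (2 * (1 / 20)) (1 / 20) R ((1 - 7 / 8) / max 1 R)
      (Real.sqrt 2 / (1 - 7 / 8))) ∧
    (∀ (βW : ℝ), 0 ≤ βW → βW ≤ 1 / 12 → ∀ (x : Site 4) (w : (zdGraph 4).Walk x x) (t : ℝ),
      ∀ μ ∈ ymGibbsMeasures (d := 4) (fundamentalRep (Fin 2)) (2 * (βW / 4)),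
      ∀ ν ∈ perturbedGibbsMeasures (d := 4) (fundamentalRep (Fin 2)) (2 * (βW / 4))
        (loopFamilyAction 2 (fun _ : Unit => (⟨x, w⟩ : ZdLoop 4)) (fun _ => t))
        (loopSupp (fun _ : Unit => (⟨x, w⟩ : ZdLoop 4))),
      ∀ (F : LGConfig 4 (Matrix.specialUnitaryGroup (Fin 2) ℂ) → ℝ) (Λ : Finset (ZdEdge 4)) (KF : ℝ≥0),
        IsLipschitzCylinder (fundamentalRep (Fin 2)) F Λ KF →
          |(∫ σ, F σ ∂μ) - ∫ σ, F σ ∂ν| ≤ 4 * Real.sqrt 2 * (1 / 2) ^ ⌊setDistEdges Λ (walkEdges w)⌋₊ * (Λ.card * KF))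

/-- T_H holds. -/
theorem T64a_LocalSourceScreening_holds : T64a_LocalSourceScreening :=
  ⟨fun _ _ _ _ R hρ hh h1 => su2_localScreeningOnBallZd_dim4 R hρ hh h1, su2_localScreeningOnBallZd_1_8,
    fun _ h0 h _ w t _ hμ _ hν _ _ _ hF => su2_wilson_singleLoop_upTo_oneTwelfth h0 h w t hμ hν hF⟩

/-- **T_I — track Y2, SCREENING FOR EVERY `N ≥ 2`, EVERY `d ≥ 1`, HYPOTHESIS-FREE** (Bakry–Émery one-link pair,
`b = 2(d−1)|β| < 1/2`, 't Hooft `β`): `6(d−1)|β| e^{ε₀}/(1/2 − b) + e^{ε₀/2} ε₁/√(N(1/2 − b)) ≤ ρ`, `1/2 ≤ ρ < 1 ⇒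
LocalScreeningOnBallZd d N β ε₀ ε₁ R ((1−ρ)/max(1,R)) (√N/(1−ρ))` (`RobustBall.suN_localScreeningOnBallZd_bakryEmery`). -/
def T64b_LocalSourceScreeningSUN : Prop :=
  ∀ (d N : ℕ), 1 ≤ d → 2 ≤ N → ∀ (β ε₀ ε₁ ρ R : ℝ), |β| * (2 * ((d : ℝ) - 1)) < 1 / 2 →
    6 * ((d : ℝ) - 1) * |β| * Real.exp ε₀ / (1 / 2 - |β| * (2 * ((d : ℝ) - 1))) +
        Real.exp (ε₀ / 2) * ε₁ / Real.sqrt ((N : ℝ) * (1 / 2 - |β| * (2 * ((d : ℝ) - 1)))) ≤ ρ →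
    1 / 2 ≤ ρ → ρ < 1 → LocalScreeningOnBallZd d N β ε₀ ε₁ R ((1 - ρ) / max 1 R) (Real.sqrt N / (1 - ρ))

/-- T_I holds. -/
theorem T64b_LocalSourceScreeningSUN_holds : T64b_LocalSourceScreeningSUN :=
  fun _ _ hd hN _ _ _ _ R hb hρ hh h1 => suN_localScreeningOnBallZd_bakryEmery hd hN R hb hρ hh h1

/-- **T_J — track Y2, TIER 2: LOCAL SOURCES ARE SCREENED AT THE WEIGHT RATE, UNIFORMLY ON THE WEIGHTED BALL; `SU(2)`, `d = 4`,
HYPOTHESIS-FREE** ('t Hooft `β_W/4`): for every weight `t ≥ 0` and loads `(a, Λ)` with `6|β_W| e^{a} e^{t} + e^{a/2} √(2/3) Λ < 1`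
(the door of T27 (i) / T32 / T_A), every member `W` of `MemBallZdS a Λ t` (INFINITE range), every continuous link-summable source `V`
of ANY strength whose one-link oscillation loads (`≤ B`) vanish off a finite link set `S`, every DLR state `μ` of `W`, EVERY DLR
state `ν` of `W + V`, and every Lipschitz cylinder `F` (`Λ_F`, `K_F`):
`|∫F dμ − ∫F dν| ≤ (√2/2)·min(B,4)/(1 − ρ) · e^{−t·d(Λ_F,S)} · #Λ_F · K_F`, `ρ = 6|β_W| e^{a} e^{t} + e^{a/2} √(2/3) Λ` — RATE = WEIGHT
(`RobustBall.su2_localScreeningS_dim4`, seat rb-p1, via the new Literature theorem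
`DobrushinMetric.abs_integral_sub_integral_le_of_gibbs_pair_tsum` — Föllmer's comparison with defects, summable rows). -/
def T64c_LocalSourceScreeningTierTwo : Prop :=
  ∀ (βW a Λ t : ℝ), 0 ≤ t → 6 * |βW| * (Real.exp a * Real.exp t) + Real.exp (a / 2) * Real.sqrt (2 / 3) * Λ < 1 →
    ∀ (W V : Potential (ZdEdge 4) (Matrix.specialUnitaryGroup (Fin 2) ℂ)), MemBallZdS a Λ t W →
    ∀ (BV : Finset (ZdEdge 4) → ℝ), IsLinkSummable V BV → (∀ X, Continuous (V X)) →
      (∀ X, DependsOn (V X) (↑X : Set (ZdEdge 4))) →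
    ∀ (oscV : Finset (ZdEdge 4) → ZdEdge 4 → ℝ), (∀ X, Dobrushin.IsOscBound (V X) (oscV X)) →
      (∀ e, Summable fun X : Finset (ZdEdge 4) => (if e ∈ X then oscV X e else 0)) →
    ∀ (B : ℝ) (S : Finset (ZdEdge 4)), (∀ e, ∑' X : Finset (ZdEdge 4), (if e ∈ X then oscV X e else 0) ≤ B) →
      (∀ e, e ∉ S → ∑' X : Finset (ZdEdge 4), (if e ∈ X then oscV X e else 0) ≤ 0) →
    ∀ μ ∈ perturbedGibbsMeasuresS (d := 4) (fundamentalRep (Fin 2)) (2 * (βW / 4)) W,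
    ∀ ν ∈ perturbedGibbsMeasuresS (d := 4) (fundamentalRep (Fin 2)) (2 * (βW / 4)) (W + V),
    ∀ (F : LGConfig 4 (Matrix.specialUnitaryGroup (Fin 2) ℂ) → ℝ) (ΛF : Finset (ZdEdge 4)) (KF : ℝ≥0),
      IsLipschitzCylinder (fundamentalRep (Fin 2)) F ΛF KF →
        |(∫ σ, F σ ∂μ) - ∫ σ, F σ ∂ν| ≤
          Real.sqrt 2 / 2 * min B 4 / (1 - (6 * |βW| * (Real.exp a * Real.exp t) + Real.exp (a / 2) * Real.sqrt (2 / 3) * Λ)) *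
            Real.exp (-t * setDistEdges ΛF S) * (ΛF.card * KF)

/-- T_J holds. -/
theorem T64c_LocalSourceScreeningTierTwo_holds : T64c_LocalSourceScreeningTierTwo :=
  fun _ _ _ _ ht hρ _ _ hmem _ hV hVc hVdep _ hoscV hoscVs _ _ hB hS _ hμ _ hν _ _ _ hF =>
    su2_localScreeningS_dim4 ht hρ hmem hV hVc hVdep hoscV hoscVs (bV := fun e => ∑' X : Finset (ZdEdge 4),
      (if e ∈ X then _ else 0)) (fun _ => le_rfl) hB hS hμ hν hF

/-- **T_K — track Y2, THE THERMODYNAMIC LIMIT OF THE ACTION AT THE CLUSTERING RATE; `SU(2)`, `d = 4`, HYPOTHESIS-FREE**: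
`6|β_W| e^{ε₀} + e^{ε₀/2} √(2/3) ε₁ ≤ ρ`, `1/2 ≤ ρ < 1`, `n₀ ≤ n`: for every member `(W, supp)` of `MemBallZd ε₀ ε₁ R`, every adapted
truncation `W₂` keeping the terms inside the box `‖base‖_∞ ≤ n` (`W₂ X = W X` there) and killing-or-keeping the rest
(`W₂ X = W X ∨ W₂ X = 0`), every DLR `μ` of `W`, EVERY DLR `ν` of `W₂`, every Lipschitz cylinder `F` on links of `‖base‖_∞ ≤ n₀`:
`|∫F dμ − ∫F dν| ≤ √2·min(ε₀,4)/(1−ρ) · e^{−((1−ρ)/max(1,R))(n − n₀)} · #Λ · K_F` (`RobustBall.su2_truncation_dim4`, seat rb-p1). -/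
def T64d_ActionTruncationRate : Prop :=
  ∀ (βW ε₀ ε₁ ρ R n₀ n : ℝ), n₀ ≤ n → 6 * |βW| * Real.exp ε₀ + Real.exp (ε₀ / 2) * Real.sqrt (2 / 3) * ε₁ ≤ ρ →
    1 / 2 ≤ ρ → ρ < 1 →
    ∀ (W W₂ : Potential (ZdEdge 4) (Matrix.specialUnitaryGroup (Fin 2) ℂ))
      (supp : Finset (ZdEdge 4) → Finset (Finset (ZdEdge 4))), MemBallZd ε₀ ε₁ R W supp → W₂.IsAdapted →
      (∀ X : Finset (ZdEdge 4), (∀ z ∈ X, ‖z.1‖ ≤ n) → W₂ X = W X) → (∀ X : Finset (ZdEdge 4), W₂ X = W X ∨ W₂ X = 0) →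
    ∀ μ ∈ perturbedGibbsMeasures (d := 4) (fundamentalRep (Fin 2)) (2 * (βW / 4)) W supp,
    ∀ ν ∈ perturbedGibbsMeasures (d := 4) (fundamentalRep (Fin 2)) (2 * (βW / 4)) W₂ supp,
    ∀ (F : LGConfig 4 (Matrix.specialUnitaryGroup (Fin 2) ℂ) → ℝ) (Λ : Finset (ZdEdge 4)) (KF : ℝ≥0),
      IsLipschitzCylinder (fundamentalRep (Fin 2)) F Λ KF → (∀ y ∈ Λ, ‖y.1‖ ≤ n₀) →
        |(∫ σ, F σ ∂μ) - ∫ σ, F σ ∂ν| ≤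
          Real.sqrt 2 * min ε₀ 4 / (1 - ρ) * Real.exp (-((1 - ρ) / max 1 R) * (n - n₀)) * (Λ.card * KF)

/-- T_K holds. -/
theorem T64d_ActionTruncationRate_holds : T64d_ActionTruncationRate :=
  fun _ _ _ _ _ _ _ hn hρ hh h1 _ _ _ hmem hW₂ hin hout _ hμ _ hν _ _ _ hF hΛ =>
    su2_truncation_dim4 hn hρ hh h1 hmem hW₂ hin hout hμ hν hF hΛ

/-- **T_L — track Y2, TIER 2 ON THE LOOP-ACTION NORM BALL: INSERTED LOOPS ARE SCREENED, HALVING PER LATTICE STEP; `SU(2)`, `d = 4`,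
HYPOTHESIS-FREE**: at `β_W = 1/20` (bare `1/40`), for every generic Wilson-type loop action `W = loopFamilyAction 2 γ₀ c₀` on `ℤ⁴` with
finite carrier fibres and `‖c₀‖_{log 2} ≤ 1/10`, every further loop family `γ` (finite carrier fibres, couplings of ANY size
`‖c‖₀ ≤ ε_V`, carriers inside the finite link set `S`), every DLR `μ` of `W`, EVERY DLR `ν` of `W + loopFamilyAction 2 γ c`, and
every Lipschitz cylinder `F` (`Λ_F`, `K_F`): `|∫F dμ − ∫F dν| ≤ (50√2/17)·min(2ε_V,4) · e^{−(log 2)·d(Λ_F,S)} · #Λ_F · K_F`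
(`RobustBall.su2_loopBall_loopSourceS_1_20`, seat rb-p1; row sum `≤ 83/100`). -/
def T64e_LoopBallSourceScreening : Prop :=
  ∀ (ι₀ : Type) (γ₀ : ι₀ → ZdLoop 4) (c₀ : ι₀ → ℝ), (∀ X, {i | walkEdges (γ₀ i).walk = X}.Finite) →
    LoopNormLE (Real.log 2) γ₀ c₀ (1 / 10) →
  ∀ (ι : Type) (γ : ι → ZdLoop 4) (c : ι → ℝ), (∀ X, {i | walkEdges (γ i).walk = X}.Finite) →
  ∀ (εV : ℝ), LoopNormLE 0 γ c εV → ∀ (S : Finset (ZdEdge 4)), (∀ i, walkEdges (γ i).walk ⊆ S) →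
  ∀ μ ∈ perturbedGibbsMeasuresS (d := 4) (fundamentalRep (Fin 2)) (2 * ((1 / 20 : ℝ) / 4)) (loopFamilyAction 2 γ₀ c₀),
  ∀ ν ∈ perturbedGibbsMeasuresS (d := 4) (fundamentalRep (Fin 2)) (2 * ((1 / 20 : ℝ) / 4))
    (loopFamilyAction 2 γ₀ c₀ + loopFamilyAction 2 γ c),
  ∀ (F : LGConfig 4 (Matrix.specialUnitaryGroup (Fin 2) ℂ) → ℝ) (ΛF : Finset (ZdEdge 4)) (KF : ℝ≥0),
    IsLipschitzCylinder (fundamentalRep (Fin 2)) F ΛF KF →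
      |(∫ σ, F σ ∂μ) - ∫ σ, F σ ∂ν| ≤
        50 * Real.sqrt 2 / 17 * min (2 * εV) 4 * Real.exp (-Real.log 2 * setDistEdges ΛF S) * (ΛF.card * KF)

/-- T_L holds. -/
theorem T64e_LoopBallSourceScreening_holds : T64e_LoopBallSourceScreening :=
  fun _ _ _ hfin₀ hnorm₀ _ _ _ hfin _ hnorm _ hS _ hμ _ hν _ _ _ hF =>
    su2_loopBall_loopSourceS_1_20 hfin₀ hnorm₀ hfin hnorm hS hμ hν hF



end V23_rbp1_Screening

/-! ### DEFAULT GROUPING (p2): one consolidating conjunction per owner file — `G_<tag> := T_a ∧ T_b ∧ …` + `_holds`.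
The lead composes V23 by theme; p3 renames `G_<tag> ↦ T<k>_<Name>` (via --map) or regroups at will; these are additions, not owner bytes. -/
section V23_groups

/-- Default group for section `V23_rbp1_Screening`: the conjunction of its 5 owner texts. -/
def T64_SourceScreeningAndTruncation : Prop :=
  T64a_LocalSourceScreening ∧ T64b_LocalSourceScreeningSUN ∧ T64c_LocalSourceScreeningTierTwo ∧ T64d_ActionTruncationRate ∧ T64e_LoopBallSourceScreening

/-- `T64_SourceScreeningAndTruncation` holds (componentwise by the owners' `_holds`). -/
theorem T64_SourceScreeningAndTruncation_holds : T64_SourceScreeningAndTruncation :=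
  ⟨T64a_LocalSourceScreening_holds, T64b_LocalSourceScreeningSUN_holds, T64c_LocalSourceScreeningTierTwo_holds, T64d_ActionTruncationRate_holds, T64e_LoopBallSourceScreening_holds⟩

end V23_groups

end Summit.Ventures.YMGap

end
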